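import Literature.NumberTheory.GaloisRepresentations.IdeleClassFundamentalClassArtin
import Literature.NumberTheory.GaloisRepresentations.GlobalReciprocityArtinTheta
import HarnessLib

/-!
# The class formation's pairing at a cyclic layer read through THE universal norm residue symbol `θ : C_F → Γ_F^ab`
# (Tate, C–F VII §11.3 with §5.4; Neukirch III (6.14))

Topic `NumberTheory/GaloisRepresentations`; namespace `Literature.NumberTheory.GaloisRepresentations.IdeleCohomology`
(sequel to `IdeleClassFundamentalClassArtin` and `GlobalReciprocityArtinTheta`).  Theorems only (no definition, no named
fact, no instance, no notation, no `sorry`); number fields in `Type`.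

For `E/F` cyclic with generator `σ`, `n = [E:F]`, `θ = (isCompatibleSystem_artinMapFamily hR).theta` the tree's universal
norm residue symbol (a global reciprocity map: `isGlobalReciprocityMap_artinTheta`), `E₀ = embeddedField F E ⊆ F̄`,
`e : E ≃ E₀`:

* **`carryInv_eq_neg_exponent_theta`**: `classInv [c_σ · ι[x]] = −ι_σ(e⁻¹ (γ|_{E₀}) e)/n` for ANY representative
  `γ ∈ Γ_F` of `θ[x]` — the pairing `inv(ι[x] ∪ δχ_σ)` is `−χ_σ` of the image of `θ[x]` in `Gal(E/F)`;
* **`carryInv_eq_zero_iff_theta_mem`**: `classInv [c_σ · ι[x]] = 0 ↔ θ[x]` lies in the image of `Gal(F̄/E₀)` in `Γ_F^ab`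
  — the kernel of the class formation's pairing with the characters of the cyclic layer `E` is `θ⁻¹(Gal(F^{ab}/E))`, the
  form in which door-c6 g11's `IsGlobalReciprocityMap.mem_range_pow_iff_forall_character` (`α¹(Γ_F, ℤ/m)` injective)
  is consumed by Route A (A5).

HONEST FRAMING: classical; no case of BSD / Poitou–Tate; cell bsd-schneider, crux `AnticycControlAdditiveK`.

## References
* J. W. S. Cassels, A. Fröhlich (eds.), *Algebraic Number Theory* (1967), Ch. VII (J. Tate) §11.3, §5.4. [CasselsFrohlichANT1967]
* J. Neukirch, *Class Field Theory — The Bonn Lectures* (2013), Part III §6 (6.14). [Neukirch2013]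
-/

noncomputable section

open NumberField IsDedekindDomain CategoryTheory groupCohomology Function Field
open Literature.NumberTheory.Automorphic

namespace Literature.NumberTheory.GaloisRepresentations

namespace IdeleCohomology

open Literature.Algebra.Homology IdeleClassGroup

variable {F : Type} [Field F] [NumberField F] {E : Type} [Field E] [NumberField E] [Algebra F E] [IsGalois F E]
variable [IsCyclic (E ≃ₐ[F] E)] (σ : E ≃ₐ[F] E) (hσ : ∀ g, g ∈ Subgroup.zpowers σ)

/-- **`classInv [c_σ · ι[x]] = −ι_σ(θ[x]|_E)/n`**: for any `γ ∈ Γ_F` representing the universal symbol `θ[x]`,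
`carryInv σ x = −ι_σ(e⁻¹ (γ|_{E₀}) e)/n` (`e : E ≃ E₀ ⊆ F̄`).
[cite: CasselsFrohlichANT1967, Ch. VII §11.3, §5.4][cite: Neukirch2013, Part III §6 (6.14)] -/
theorem carryInv_eq_neg_exponent_theta (x : ideleGroup F) {γ : absoluteGaloisGroup F}
    (hγ : absGaloisAbProj F γ =
      (isCompatibleSystem_artinMapFamily (K := F) artinReciprocity_character_holds).theta (QuotientGroup.mk x)) :
    carryInv (E := E) σ hσ x =
      -(((((Unramified.exponent σ hσ
            (haveI := IsAbelianGalois.of_isCyclic F E;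
              (embeddedEquiv F E).autCongr.symm (absRestrictNormalHom (embeddedField F E) γ)) : ℕ) : ℚ)) /
          (Nat.card (E ≃ₐ[F] E) : ℕ) : ℚ) : AddCircle (1 : ℚ)) := by
  haveI := IsAbelianGalois.of_isCyclic F E
  rw [carryInv_eq_neg_exponent_artin, ← autCongr_symm_absRestrictNormalHom_eq_artinIdeleMapOfAlgebra E hγ]

/-- **`classInv [c_σ · ι[x]] = 0 ↔ θ[x] ∈ Gal(F^{ab}/E₀)`** (the image of `Gal(F̄/E₀)` in `Γ_F^ab`): the kernel of the
pairing of `ι[x]` with the characters of the cyclic layer `E` is `θ⁻¹` of the subgroup fixing `E`.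
[cite: CasselsFrohlichANT1967, Ch. VII §11.3, §5.4][cite: Neukirch2013, Part III §6 (6.14)] -/
theorem carryInv_eq_zero_iff_theta_mem (x : ideleGroup F) :
    carryInv (E := E) σ hσ x = 0 ↔
      (isCompatibleSystem_artinMapFamily (K := F) artinReciprocity_character_holds).theta (QuotientGroup.mk x) ∈
        (haveI := IsAbelianGalois.of_isCyclic F E; abelianizedFixingSubgroup F (embeddedField F E)) := by
  haveI := IsAbelianGalois.of_isCyclic F E
  rw [carryInv_eq_zero_iff, ← ker_artinIdeleMapOfAlgebra F E artinReciprocity_character_holds, MonoidHom.mem_ker,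
    artinIdeleMapOfAlgebra_eq_one_iff_theta_mem]

/-- **`classInv [c_σ · ι[x]]` depends on `x` only through `θ[x] ∈ Γ_F^ab`.**
[cite: CasselsFrohlichANT1967, Ch. VII §11.3, §5.4] -/
theorem carryInv_eq_of_theta_eq {x y : ideleGroup F}
    (h : (isCompatibleSystem_artinMapFamily (K := F) artinReciprocity_character_holds).theta (QuotientGroup.mk x) =
      (isCompatibleSystem_artinMapFamily (K := F) artinReciprocity_character_holds).theta (QuotientGroup.mk y)) :
    carryInv (E := E) σ hσ x = carryInv σ hσ y := by
  obtain ⟨γ, hγ, -⟩ :=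
    (isCompatibleSystem_artinMapFamily (K := F) artinReciprocity_character_holds).exists_absGaloisAbProj_eq_theta
      (QuotientGroup.mk x)
  rw [carryInv_eq_neg_exponent_theta σ hσ x hγ, carryInv_eq_neg_exponent_theta σ hσ y (hγ.trans h)]

end IdeleCohomology

end Literature.NumberTheory.GaloisRepresentations

end
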